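import Summits.Ventures.Crystal3D.Theorems.StickyWulffConstantTextureLiminfFluxZigzag
import HarnessLib

/-!
# The FLUX COUNT of a clamped Barlow plate: the strip-weighted volume of a unit slice is at most the number of zigzag
# lines with a site in a window of the plate (lane T, the T-side port of lane G's walker ledger; crux `TextureLiminf`,
# stmt-Ventures-19483)

HONEST FRAMING. Venture `Summits/Ventures/Crystal3D` (cell `crystal3d-full`), helper `--supports` the crux
`TextureLiminf` (stmt-Ventures-19483) of `route-Ventures-StickyWulffConstant`, registered line `TexShadow` (v6.6; cf-p1
ROUTE.md §86(42) AK: flux count of the per-top walker families, owner wulff-p2).  Rung credit only; F-C1 not moved.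

Assembly of `…FluxChart` (slab volume = `(√3/2)·√(2/3)·∫` over the lines), `…FluxLines` / `…FluxDrift` (weighted length
`≤ 1`, unit cells, lateral drift), `…FluxPolyline` / `…FluxZigzag` (the model zigzag polyline of the plate: sites, rises in
`[1/4, 1]`) and the isometry `w ↦ L w + s` of the cell:

* `volume_preimage_one_sub` — `τ ↦ 1 − τ` preserves Lebesgue measure (the downward-axis orientation);
* `volume_inter_laySlab_eq_model` — `|S ∩ laySlab L s i|` equals the model volume of `(L· + s)⁻¹ S` in the model slab `i`;
* `volume_modelSlab_zigStep` — the model slab traversed at polyline step `k` has volume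
  `(√3/2)√(2/3)·∫⁻_x |{τ ∈ (0,1) : zigChart' (zigVertex k) (zigStep k) (τ, x) ∈ S'}|` (both orientations);
* **`plate_lines_ge_flux`** — for a unit vector `e`, a measurable `S` of finite volume inside `{z₁ ≤ ⟪p,e⟫ ≤ z₁+1}` and the
  cylinder of radius `ρ'` about the `e₃`-axis, a height `H` with `H + 1 ≤ z₁ − 3`, and ANY finite set `T ⊆ ℤ²` of lattice
  lines containing every line with a SITE `L(zigVertex k + t₀u + t₁v) + s` of e-height in `[H, H+1]` within axis distance
  `ρ' + 4 + 4(z₁ + 4 − H)`:  `Σ'_i plateFlux τ₀ L σ e i · |S ∩ laySlab L s i| ≤ #T`.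
In the wall cell (`e = e₃`, `S` = the unit slice of `BilayerWallAt`, `z₁ = 0`, `H = −R₀ − 4`, `R₀ ≥ 1`) the right-hand side
is the number of zigzag lines of the bottom plate through the window `{−R₀−4 ≤ z ≤ −R₀−3} × disc(ρ + 4R₀ + 20)` — the index
set of its CAP-START walker family (F4, with 19480-p2; those sites are plate balls by the plate's completeness) — and by
`charge_le_flux` the left-hand sides of the two plates dominate `2·Q(c)` for every flux-dominated table `c`.
WHAT THIS IS NOT: not the walker family (injectivity / ends) and not the stub; F-C1 not moved.
-/

noncomputable section

namespace Summit.Ventures.Crystal3D.Theorems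

open MeasureTheory Set
open scoped ENNReal InnerProductSpace
open Literature.MathematicalPhysics.StatisticalMechanics (IsHaggSeq triangularVec₁ triangularVec₂)
open Summit.Ventures.Crystal3D.Cruxes.TextureLiminf.TexShadow (E3 stacking laySlab bilayerRise PlateLaunchable plateFlux)

/-! ## Three transfers -/

/-- `τ ↦ 1 − τ` preserves Lebesgue measure. -/
theorem volume_preimage_one_sub (A : Set ℝ) : volume ((fun τ : ℝ => 1 - τ) ⁻¹' A) = volume A := by
  have h : (fun τ : ℝ => 1 - τ) = (fun t : ℝ => 1 + t) ∘ (fun τ : ℝ => (-1 : ℝ) * τ) := by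
    funext τ; simp; ring
  rw [h, Set.preimage_comp, Real.volume_preimage_mul_left (by norm_num), measure_preimage_add]
  simp

/-- **The cell isometry**: `|S ∩ laySlab L s i|` is the model volume of `(L· + s)⁻¹ S` inside the model slab `i`. -/
theorem volume_inter_laySlab_eq_model (L : E3 ≃ₗᵢ[ℝ] E3) (s : E3) (S : Set E3) (hS : MeasurableSet S) (i : ℤ) :
    volume (S ∩ laySlab L s i) = volume ((fun w => L w + s) ⁻¹' S ∩
      {r : E3 | (i : ℝ) * Real.sqrt (2 / 3) < r 2 ∧ r 2 < ((i : ℝ) + 1) * Real.sqrt (2 / 3)}) := by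
  set φ : E3 → E3 := fun p => L.symm (p - s) with hφ
  have hφmp : MeasurePreserving φ volume volume :=
    (L.symm.measurePreserving).comp (measurePreserving_sub_right volume s)
  have hcont : Continuous fun w : E3 => L w + s := L.continuous.add continuous_const
  have h2 : Measurable fun r : E3 => r 2 := (EuclideanSpace.proj (2 : Fin 3)).continuous.measurable
  have hslab : MeasurableSet {r : E3 | (i : ℝ) * Real.sqrt (2 / 3) < r 2 ∧ r 2 < ((i : ℝ) + 1) * Real.sqrt (2 / 3)} :=
    (measurableSet_lt measurable_const h2).inter (measurableSet_lt h2 measurable_const)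
  have hset : S ∩ laySlab L s i = φ ⁻¹' ((fun w => L w + s) ⁻¹' S ∩
      {r : E3 | (i : ℝ) * Real.sqrt (2 / 3) < r 2 ∧ r 2 < ((i : ℝ) + 1) * Real.sqrt (2 / 3)}) := by
    ext p
    have hLφ : L (φ p) + s = p := by simp [hφ]
    simp only [Set.mem_inter_iff, Set.mem_preimage, Set.mem_setOf_eq, hLφ, laySlab, Set.mem_image]
    constructor
    · rintro ⟨hp, r, hr, hrp⟩
      have : φ p = r := by rw [hφ]; simp [← hrp]
      rw [this]; exact ⟨hp, hr⟩
    · rintro ⟨hp, hr⟩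
      exact ⟨hp, φ p, hr, hLφ⟩
  rw [hset, hφmp.measure_preimage (((hcont.measurable hS).inter hslab).nullMeasurableSet)]

/-- **The model slab traversed at polyline step `k`, as an integral over the lines** (both axis orientations). -/
theorem volume_modelSlab_zigStep {σ : ℤ → ℤ} (hσ : IsHaggSeq σ) (L : E3 ≃ₗᵢ[ℝ] E3) (e : E3)
    (S' : Set E3) (hS' : MeasurableSet S') (k : ℤ) :
    volume (S' ∩ {r : E3 | (zigSlab L e k : ℝ) * Real.sqrt (2 / 3) < r 2 ∧
        r 2 < ((zigSlab L e k : ℝ) + 1) * Real.sqrt (2 / 3)}) =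
      ENNReal.ofReal (Real.sqrt 3 / 2 * Real.sqrt (2 / 3)) *
        ∫⁻ x : Fin 2 → ℝ, volume {τ : ℝ | zigChart' (zigVertex L σ e k) (zigStep L σ e k) (τ, x) ∈ S' ∧ 0 < τ ∧ τ < 1} := by
  have hB0 : 0 < Real.sqrt (2 / 3) := Real.sqrt_pos.2 (by norm_num)
  have hΓ2 := zigVertex_apply_two (L := L) hσ e k
  obtain ⟨-, -, hD2⟩ := zigStep_spec L e σ k
  by_cases hs : 0 ≤ (L.symm e) 2
  · have hsl : zigSlab L e k = k := by simp [zigSlab, hs]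
    have hly : zigLayer L e k = k := by simp [zigLayer, hs]
    have hax : axisSign L e = 1 := by simp [axisSign, hs]
    rw [hly] at hΓ2; rw [hax, one_mul] at hD2
    have hD : 0 < zigStep L σ e k 2 := by rw [hD2]; exact hB0
    have hslab : {r : E3 | (zigSlab L e k : ℝ) * Real.sqrt (2 / 3) < r 2 ∧ r 2 < ((zigSlab L e k : ℝ) + 1) * Real.sqrt (2 / 3)} =
        {w : E3 | zigVertex L σ e k 2 < w 2 ∧ w 2 < zigVertex L σ e k 2 + zigStep L σ e k 2} := by
      ext w; rw [hsl, hΓ2, hD2]; constructor <;> rintro ⟨h1, h2⟩ <;> constructor <;> linarith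
    rw [hslab, volume_inter_laySlab_eq_lintegral_zigChart _ _ hD S' hS', hD2]
  · have hsl : zigSlab L e k = -k - 1 := by simp [zigSlab, hs]
    have hly : zigLayer L e k = -k := by simp [zigLayer, hs]
    have hax : axisSign L e = -1 := by simp [axisSign, hs]
    rw [hly] at hΓ2; rw [hax, neg_one_mul] at hD2
    -- base `Γ k + D`, step `−D`
    have hD : 0 < (-zigStep L σ e k) 2 := by rw [PiLp.neg_apply, hD2, neg_neg]; exact hB0
    have hslab : {r : E3 | (zigSlab L e k : ℝ) * Real.sqrt (2 / 3) < r 2 ∧ r 2 < ((zigSlab L e k : ℝ) + 1) * Real.sqrt (2 / 3)} =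
        {w : E3 | (zigVertex L σ e k + zigStep L σ e k) 2 < w 2 ∧
          w 2 < (zigVertex L σ e k + zigStep L σ e k) 2 + (-zigStep L σ e k) 2} := by
      ext w; rw [hsl, PiLp.add_apply, PiLp.neg_apply, hΓ2, hD2]; push_cast
      constructor <;> rintro ⟨h1, h2⟩ <;> constructor <;> linarith
    rw [hslab, volume_inter_laySlab_eq_lintegral_zigChart _ _ hD S' hS', PiLp.neg_apply, hD2, neg_neg]
    congr 1
    refine lintegral_congr fun x => ?_
    have hset : {τ : ℝ | zigChart' (zigVertex L σ e k + zigStep L σ e k) (-zigStep L σ e k) (τ, x) ∈ S' ∧ 0 < τ ∧ τ < 1} =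
        (fun τ : ℝ => 1 - τ) ⁻¹' {τ : ℝ | zigChart' (zigVertex L σ e k) (zigStep L σ e k) (τ, x) ∈ S' ∧ 0 < τ ∧ τ < 1} := by
      ext τ
      simp only [Set.mem_setOf_eq, Set.mem_preimage]
      have : zigChart' (zigVertex L σ e k + zigStep L σ e k) (-zigStep L σ e k) (τ, x) =
          zigChart' (zigVertex L σ e k) (zigStep L σ e k) (1 - τ, x) := by
        simp only [zigChart', smul_neg, sub_smul, one_smul]; abel
      rw [this]
      constructor
      · rintro ⟨h, h0, h1⟩; exact ⟨h, by linarith, by linarith⟩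
      · rintro ⟨h, h0, h1⟩; exact ⟨h, by linarith, by linarith⟩
    rw [hset, volume_preimage_one_sub]

/-! ## The flux count -/

/-- `√2 · (√3/2) · √(2/3) = 1`. -/
theorem sqrt_two_mul_det : Real.sqrt 2 * (Real.sqrt 3 / 2 * Real.sqrt (2 / 3)) = 1 := by
  rw [show Real.sqrt 3 / 2 * Real.sqrt (2 / 3) = Real.sqrt 3 * Real.sqrt (2 / 3) / 2 by ring,
    ← Real.sqrt_mul (by norm_num) (2 / 3), show (3 : ℝ) * (2 / 3) = 2 by norm_num]
  have h2 : Real.sqrt 2 * Real.sqrt 2 = 2 := Real.mul_self_sqrt (by norm_num)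
  linarith

/-- **The flux count of a clamped Barlow plate.**  See the module docstring. -/
theorem plate_lines_ge_flux {σ : ℤ → ℤ} (hσ : IsHaggSeq σ) (L : E3 ≃ₗᵢ[ℝ] E3) (s e : E3) (he : ‖e‖ = 1)
    (τ₀ ρ' z₁ H : ℝ) (hH : H + 1 ≤ z₁ - 3) (S : Set E3) (hSm : MeasurableSet S) (hSfin : volume S ≠ ⊤)
    (hS : S ⊆ {p : E3 | z₁ ≤ ⟪p, e⟫_ℝ ∧ ⟪p, e⟫_ℝ ≤ z₁ + 1 ∧ Real.sqrt (p 0 ^ 2 + p 1 ^ 2) ≤ ρ'})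
    (T : Finset (Fin 2 → ℤ))
    (hT : ∀ t : Fin 2 → ℤ, (∃ k : ℤ,
        H ≤ ⟪L (zigVertex L σ e k + ((t 0 : ℝ) • triangularVec₁ 1 + (t 1 : ℝ) • triangularVec₂ 1)) + s, e⟫_ℝ ∧
        ⟪L (zigVertex L σ e k + ((t 0 : ℝ) • triangularVec₁ 1 + (t 1 : ℝ) • triangularVec₂ 1)) + s, e⟫_ℝ ≤ H + 1 ∧
        Real.sqrt ((L (zigVertex L σ e k + ((t 0 : ℝ) • triangularVec₁ 1 + (t 1 : ℝ) • triangularVec₂ 1)) + s) 0 ^ 2 +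
          (L (zigVertex L σ e k + ((t 0 : ℝ) • triangularVec₁ 1 + (t 1 : ℝ) • triangularVec₂ 1)) + s) 1 ^ 2) ≤
          ρ' + 4 + 4 * (z₁ + 4 - H)) → t ∈ T) :
    ∑' i : ℤ, plateFlux τ₀ L σ e i * (volume (S ∩ laySlab L s i)).toReal ≤ (T.card : ℝ) := by
  classical
  by_cases hl : PlateLaunchable τ₀ L σ e
  swap
  · have : ∀ i, plateFlux τ₀ L σ e i = 0 := fun i => by rw [plateFlux, if_neg hl]
    simp [this]
  have hpf : ∀ i, plateFlux τ₀ L σ e i = Real.sqrt 2 * bilayerRise L σ e i := fun i => by rw [plateFlux, if_pos hl]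
  -- the polyline and its rises
  set ν : E3 := L.symm e with hν
  have hνn : ‖ν‖ = 1 := by rw [hν, LinearIsometryEquiv.norm_map, he]
  set Γ : ℤ → E3 := zigVertex L σ e with hΓ
  have hΓD : ∀ k, Γ (k + 1) - Γ k = zigStep L σ e k := fun k => by rw [hΓ, zigVertex_succ]; abel
  have hr : ∀ k, (1 / 4 : ℝ) ≤ ⟪Γ (k + 1) - Γ k, ν⟫_ℝ := fun k => by
    rw [hΓD, (zigStep_spec L e σ k).1]; exact quarter_le_bilayerRise L σ he _
  have hr1 : ∀ k, ⟪Γ (k + 1) - Γ k, ν⟫_ℝ ≤ 1 := fun k => by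
    rw [hΓD, (zigStep_spec L e σ k).1]; exact bilayerRise_le_one L σ he _
  have hD : ∀ k, ‖Γ (k + 1) - Γ k‖ ≤ 1 := fun k => by rw [hΓD, (zigStep_spec L e σ k).2.1]
  -- the model slice and the lateral gauge
  set S' : Set E3 := (fun w => L w + s) ⁻¹' S with hS'
  have hcont : Continuous fun w : E3 => L w + s := L.continuous.add continuous_const
  have hS'm : MeasurableSet S' := hcont.measurable hSm
  set lat : E3 → ℝ := fun w => Real.sqrt ((L w + s) 0 ^ 2 + (L w + s) 1 ^ 2) with hlat
  have hlat_sub : ∀ w y : E3, lat (w + y) ≤ lat w + ‖y‖ := by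
    intro w y
    have h := sqrt_lateral_add_le (L w + s) (L y)
    rw [LinearIsometryEquiv.norm_map] at h
    have heq : L (w + y) + s = L w + s + L y := by rw [map_add]; abel
    simp only [hlat, heq]; exact h
  have hheight : ∀ w : E3, ⟪L w + s, e⟫_ℝ = ⟪w, ν⟫_ℝ + ⟪s, e⟫_ℝ := fun w => by
    rw [inner_add_left, hν, ← LinearIsometryEquiv.inner_map_map L w (L.symm e), LinearIsometryEquiv.apply_symm_apply]
  have hS'sub : S' ⊆ {w : E3 | z₁ - ⟪s, e⟫_ℝ ≤ ⟪w, ν⟫_ℝ ∧ ⟪w, ν⟫_ℝ ≤ z₁ - ⟪s, e⟫_ℝ + 1 ∧ lat w ≤ ρ'} := by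
    intro w hw
    obtain ⟨h1, h2, h3⟩ := hS hw
    rw [hheight] at h1 h2
    exact ⟨by linarith, by linarith, h3⟩
  -- the line count
  have hcount := lintegral_weightedLength_le_card ν hνn lat hlat_sub Γ (1 / 4) (by norm_num) hr hr1 hD
    (z₁ - ⟪s, e⟫_ℝ) ρ' (H - ⟪s, e⟫_ℝ) (by linarith) S' hS'sub T (fun t ⟨k, hk1, hk2, hk3⟩ => by
      refine hT t ⟨k, ?_⟩
      have hV : zigChart' (Γ k) 0 (0, fun i => (t i : ℝ)) =
          zigVertex L σ e k + ((t 0 : ℝ) • triangularVec₁ 1 + (t 1 : ℝ) • triangularVec₂ 1) := by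
        rw [zigChart'_zero, hΓ]; abel
      rw [hV] at hk1 hk2 hk3
      rw [hheight]
      refine ⟨by linarith, by linarith, ?_⟩
      have : (z₁ - ⟪s, e⟫_ℝ + 4 - (H - ⟪s, e⟫_ℝ)) / (1 / 4) = 4 * (z₁ + 4 - H) := by ring
      rw [this] at hk3; exact hk3)
  -- the left-hand side as an integral over the lines
  set ℓ : ℤ → (Fin 2 → ℝ) → ℝ≥0∞ := fun k x =>
    volume {τ : ℝ | zigChart' (Γ k) (Γ (k + 1) - Γ k) (τ, x) ∈ S' ∧ 0 < τ ∧ τ < 1} with hℓ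
  have hℓmeas : ∀ k, Measurable (ℓ k) := by
    intro k
    have hA : MeasurableSet {p : ℝ × (Fin 2 → ℝ) | zigChart' (Γ k) (Γ (k + 1) - Γ k) p ∈ S' ∧ 0 < p.1 ∧ p.1 < 1} := by
      have h1 : MeasurableSet (zigChart' (Γ k) (Γ (k + 1) - Γ k) ⁻¹' S') := (continuous_zigChart' _ _).measurable hS'm
      have h2 : MeasurableSet {p : ℝ × (Fin 2 → ℝ) | 0 < p.1} := measurableSet_lt measurable_const measurable_fst
      have h3 : MeasurableSet {p : ℝ × (Fin 2 → ℝ) | p.1 < 1} := measurableSet_lt measurable_fst measurable_const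
      have : {p : ℝ × (Fin 2 → ℝ) | zigChart' (Γ k) (Γ (k + 1) - Γ k) p ∈ S' ∧ 0 < p.1 ∧ p.1 < 1} =
          (zigChart' (Γ k) (Γ (k + 1) - Γ k) ⁻¹' S') ∩ {p | 0 < p.1} ∩ {p | p.1 < 1} := by
        ext p; simp [and_assoc]
      rw [this]; exact (h1.inter h2).inter h3
    exact measurable_measure_prodMk_right hA
  have hLHS : ∑' i : ℤ, ENNReal.ofReal (plateFlux τ₀ L σ e i) * volume (S ∩ laySlab L s i) =
      ∫⁻ x : Fin 2 → ℝ, ∑' k : ℤ, ENNReal.ofReal ⟪Γ (k + 1) - Γ k, ν⟫_ℝ * ℓ k x := by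
    -- reindex the slabs along the polyline
    let eqv : ℤ ≃ ℤ := if 0 ≤ (L.symm e) 2 then Equiv.refl ℤ else
      ⟨fun k => -k - 1, fun k => -k - 1, fun k => by ring, fun k => by ring⟩
    have heqv : ∀ k, eqv k = zigSlab L e k := fun k => by
      by_cases hs : 0 ≤ (L.symm e) 2 <;> simp [eqv, zigSlab, hs]
    rw [← Equiv.tsum_eq eqv]
    rw [lintegral_tsum fun k => ((hℓmeas k).const_mul _).aemeasurable]
    refine tsum_congr fun k => ?_
    rw [heqv, volume_inter_laySlab_eq_model L s S hSm, volume_modelSlab_zigStep hσ L e S' hS'm k, hpf,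
      ← (zigStep_spec L e σ k).1]
    have hrk : 0 ≤ ⟪zigStep L σ e k, L.symm e⟫_ℝ := by
      rw [(zigStep_spec L e σ k).1]; linarith [quarter_le_bilayerRise L σ he (zigSlab L e k)]
    have hprod : Real.sqrt 2 * ⟪zigStep L σ e k, L.symm e⟫_ℝ * (Real.sqrt 3 / 2 * Real.sqrt (2 / 3)) =
        ⟪zigStep L σ e k, L.symm e⟫_ℝ := by
      rw [mul_comm (Real.sqrt 2), mul_assoc, sqrt_two_mul_det, mul_one]
    rw [← mul_assoc, ← ENNReal.ofReal_mul (mul_nonneg (Real.sqrt_nonneg _) hrk), hprod,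
      lintegral_const_mul _ (hℓmeas k)]
    have hΓD' : zigVertex L σ e (k + 1) - zigVertex L σ e k = zigStep L σ e k := by rw [zigVertex_succ]; abel
    simp only [hℓ, hΓ, hν, hΓD']
  have henn : ∑' i : ℤ, ENNReal.ofReal (plateFlux τ₀ L σ e i) * volume (S ∩ laySlab L s i) ≤ (T.card : ℝ≥0∞) := by
    rw [hLHS]; exact hcount
  -- back to the reals
  have hfin : ∀ i, volume (S ∩ laySlab L s i) ≠ ⊤ := fun i => ne_top_of_le_ne_top hSfin (measure_mono Set.inter_subset_left)
  have hpf0 : ∀ i, 0 ≤ plateFlux τ₀ L σ e i := fun i => by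
    rw [hpf]; exact mul_nonneg (Real.sqrt_nonneg _) (le_trans (by norm_num) (quarter_le_bilayerRise L σ he i))
  have hreal : ∑' i : ℤ, plateFlux τ₀ L σ e i * (volume (S ∩ laySlab L s i)).toReal =
      (∑' i : ℤ, ENNReal.ofReal (plateFlux τ₀ L σ e i) * volume (S ∩ laySlab L s i)).toReal := by
    rw [ENNReal.tsum_toReal_eq fun i => ENNReal.mul_ne_top ENNReal.ofReal_ne_top (hfin i)]
    refine tsum_congr fun i => ?_
    rw [ENNReal.toReal_mul, ENNReal.toReal_ofReal (hpf0 i)]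
  rw [hreal]
  have := ENNReal.toReal_mono (ENNReal.natCast_ne_top T.card) henn
  simpa using this

end Summit.Ventures.Crystal3D.Theorems

end
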